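/-
Copyright (c) 2026 the pub-hodgecm-mathlib formalisation cell (harness21).  Prover seat hodgecm-mathlib-K2E4-p18 (g3), HCML Track B «K2-LIT» ∕ h413
(stmt-HodgeConjecture-24833); line (ii′), sub-letter (H♮): FILE 5 — re-centring the rank-one package from the identity to a central `ζ` (2026-09-04).
-/
import Summits.HodgeConjecture.HodgeConjecture.Theorems.K2E3CentralUnipotentScalingOfFactor                -- ★ p856063 (this seat): the U3b frame, ★ `cosetCongr`∕comm-factor imports, ★ p23 `npow_conj_sub_one_eq_zero_iff_two`
import Literature.NumberTheory.Rogawski1990.UnitaryTwoOneCentralFarSupportCM               -- ★ `exists_coe_fst_eq_smul_one_of_mem_center` (a central element of `H_v` has scalar `U(Φ₂)`-part)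
import Literature.NumberTheory.Rogawski1990.DeltaTransferTransport                         -- ★ `isLocSmooth_comp_homeomorph`
import HarnessLib

/-!
# K2 · E3 — `Theorems/K2E3RankOneUnipotentScalingTranslate.lean` (FILE 5a): TRANSLATING THE RANK-ONE PACKAGE BY A CENTRAL SCALAR `ζ ∈ U(Φ₂)_v` — THE TRANSPORT
# OF THE SCALING LAW AND THE CLAUSE LEMMAS (Rogawski 1990 §8.1 Prop. 8.1.2 (a): descent to `Z(z)`; §4.9)

HCML Track B «K2-LIT», cell `pub/hodgecm-mathlib`, crux H413 = `stmt-HodgeConjecture-24833` (lane `--supports … --as helper`); seat `hodgecm-mathlib-K2E4-p18` (g3).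
★ p856124 `K2E3CentralUnipotentScalingPackageOfRankOne` pays (Ψ-package♮) from (Ψ-package₂⁺) `sig_K2E3RankOneUnipotentScalingPackage` (e65356adaa469942), the rank-one
package AT A CENTRAL `ζ`.  The Cayley road (★ K2E5-p12 FILE 1∕2∕3 p855742∕p855813∕p855890 + the (SC₂) C-files p856070∕p856116∕…) lives AT THE IDENTITY.  THIS FILE:
**(Ψ-package₂⁺ at every central ζ) ⟸ (Ψ-package₂¹ at 1)** (cand `K2/K2E4-p18/g3/sig_K2E3RankOneUnipotentScalingPackageOne.cand.K2E4-p18-g3.lean`), by translation with the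
central element `ζ` — a SCALAR matrix `s·1` in `GL₂(L ⊗ L⁺_v)` (★ `exists_coe_fst_eq_smul_one_of_mem_center` at `(ζ, 1) ∈ Z(H_v)`), hence commuting with every
`GL₂`-conjugator: `Ψ^ζ(γ) := Ψ(γζ⁻¹)·ζ`, `U₀^ζ := {γ | γζ⁻¹ ∈ U₀}`, `a^ζ(u) := a(⟦out u · ζ⁻¹⟧)`, start `t·ζ`.  (U1)(U2)(E)(Z)(I)(C) are group algebra with `ζ` central;
(U2st)(Est)(Sst) because stable conjugacy (`IsStablyConj = IsConj` in `GL₂`, ★) is invariant under translation by the central scalar; (S_H) through the homeomorphism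
`(γ₁, γ₂) ↦ (γ₁ζ⁻¹, γ₂)` (★ `isLocSmooth_comp_homeomorph`); (RAY⁺) from (RAY¹) (`(Ψ^ζ)^[k](tζ) = Ψ^[k]t·ζ`, `Z(gζ) = Z(g)`); and **(SC_ζ) ⟸ (SC₁) by an EXACT translation
transport**: for `x = out u` over `ζ`, `x′ = xζ⁻¹` is unipotent with `Z(x′) = Z(x)`, `y x y⁻¹ = (y x′ y⁻¹)·ζ`, so `Φ_μ(x, K) = ∫_{U₂⧸Z(x′)} K((y x′ y⁻¹)ζ) dμ′` with `μ′` the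
transport of `μ` along `U₂ ⧸ Z(x) = U₂ ⧸ Z(x′)` (★ `cosetCongrHomeomorph (refl)`); docking at `out⟦x′⟧` (★ `exists_integral_descConj_eq_smul_integral_descConj_of_conj_eq`) and
(SC₁) at the unipotent class `⟦x′⟧` for the translated test function `K(·ζ)` give the law, the constant cancelling (FILE 4a's pattern).

* §1 group∕matrix algebra with a central scalar (`comm_inv_of_comm`, `conj_mul_central`, `comm_mul_central_iff`, `centralizer_mul_central_eq`, `isConj_coe_mul_of_isConj`, `iterate_translate`).
* §2 **`classOrbitalIntegral_indicator_comp_translate_eq_mul`** — (SC_ζ) ⟸ (SC₁), any `(Ψ, U₀, q, a)`.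
* §3 clause lemmas: `coe_mul_comm_of_mem_center` (central ⇒ `GL₂`-central), `isLocalStablyConjH_mul_right`, `translate_mem_nhds` (U1), `isLocSmooth_indicator_translate` (S_H),
  `ray_translate` (RAY⁺).  The head `rankOneUnipotentScalingPackage_of_identity : ‹(Ψ-package₂¹)› → ‹(Ψ-package₂⁺)›` is FILE 5b `Theorems/K2E3RankOneUnipotentScalingPackageOfIdentity.lean`.

HONEST LABEL: HC_CM is proved only modulo the 7 printed citations (2 remaining named inputs: hLiu418 = stmt-HodgeConjecture-24832, h413 = stmt-HodgeConjecture-24833) until rung 0 closes.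
Count-neutral helper: (Ψ-package₂⁺) becomes REL ⟸ (Ψ-package₂¹).  No `sorry`, axioms ⊆ {propext, Classical.choice, Quot.sound}, no `def`, no instance, no notation.

## References
* [Rogawski1990] J. D. Rogawski, *Automorphic Representations of Unitary Groups in Three Variables*, Ann. of Math. Stud. 123 (1990): §8.1 Props. 8.1.1–8.1.2 pp. 112–114
  (descent to the centraliser of a semisimple element; homogeneity), §4.9 p. 54, §3.5 Prop. 3.5.2 (c) pp. 25–26.
* [HarishChandra1999AdmissibleDistributions] Harish-Chandra (notes by S. DeBacker, P. J. Sally, Jr.), AMS ULS 16 (1999): §3.1 Lemma 3.2.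
* [Folland1995] G. B. Folland, *A Course in Abstract Harmonic Analysis* (1995), Thm. 2.49.
-/

set_option autoImplicit false
set_option linter.dupNamespace false

noncomputable section

open Filter Topology
open MeasureTheory Measure NumberField IsDedekindDomain
open Literature.MeasureTheory.Group Literature.MeasureTheory.RestrictedProduct
open Literature.Topology.RestrictedProduct Literature.Topology.Algebra.RestrictedProduct
open Literature.NumberTheory.Rogawski1990 Literature.NumberTheory.Automorphic
open Literature.AlgebraicGeometry.ShimuraVarieties (unitaryGroup hermForm)
open scoped Matrix MatrixGroups RestrictedProduct NNReal
open Summit.HodgeConjecture.HodgeConjecture.Cruxes.H413.K2E3CentralUnipotentScalingOfFactor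
namespace Summit.HodgeConjecture.HodgeConjecture.Cruxes.H413.K2E3RankOneUnipotentScalingTranslate

variable (L : Type) [Field L] [NumberField L] [IsCMField L] (v : HeightOneSpectrum (𝓞 ↥(maximalRealSubfield L)))

/-! ## §1 Algebra with a central element of `U₂` -/

/-- If `ζ` commutes with everything then so does `ζ⁻¹`. [folklore] -/
theorem comm_inv_of_comm {G : Type*} [Group G] {ζ : G} (h : ∀ k : G, k * ζ = ζ * k) (k : G) : k * ζ⁻¹ = ζ⁻¹ * k := by
  calc k * ζ⁻¹ = ζ⁻¹ * (ζ * k) * ζ⁻¹ := by group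
    _ = ζ⁻¹ * (k * ζ) * ζ⁻¹ := by rw [h k]
    _ = ζ⁻¹ * k := by group

/-- Conjugation commutes with right translation by a central element: `x (γ m) x⁻¹ = (x γ x⁻¹) m`. [folklore] -/
theorem conj_mul_central {G : Type*} [Group G] {m : G} (hm : ∀ k : G, k * m = m * k) (x γ : G) :
    x * (γ * m) * x⁻¹ = x * γ * x⁻¹ * m := by
  calc x * (γ * m) * x⁻¹ = x * γ * (m * x⁻¹) := by simp only [mul_assoc]
    _ = x * γ * (x⁻¹ * m) := by rw [hm x⁻¹]
    _ = x * γ * x⁻¹ * m := by simp only [mul_assoc]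

/-- `y` commutes with `γ m` iff it commutes with `γ`, for `m` central. [folklore] -/
theorem comm_mul_central_iff {G : Type*} [Group G] {m : G} (hm : ∀ k : G, k * m = m * k) (y γ : G) :
    y * (γ * m) = γ * m * y ↔ y * γ = γ * y := by
  constructor
  · intro h
    have h' : y * γ * m = γ * y * m := by
      calc y * γ * m = y * (γ * m) := by rw [mul_assoc]
        _ = γ * m * y := h
        _ = γ * (m * y) := by rw [mul_assoc]
        _ = γ * (y * m) := by rw [hm y]
        _ = γ * y * m := by rw [← mul_assoc]
    exact mul_right_cancel h'
  · intro h
    calc y * (γ * m) = y * γ * m := by rw [← mul_assoc]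
      _ = γ * y * m := by rw [h]
      _ = γ * (y * m) := by rw [mul_assoc]
      _ = γ * (m * y) := by rw [hm y]
      _ = γ * m * y := by rw [← mul_assoc]

/-- `Z(γ m) = Z(γ)` for `m` central. [folklore] -/
theorem centralizer_mul_central_eq {G : Type*} [Group G] {m : G} (hm : ∀ k : G, k * m = m * k) (γ : G) :
    Subgroup.centralizer ({γ * m} : Set G) = Subgroup.centralizer ({γ} : Set G) := by
  ext y
  rw [Subgroup.mem_centralizer_singleton_iff, Subgroup.mem_centralizer_singleton_iff]
  exact comm_mul_central_iff hm y γ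

/-- **Stable conjugacy on `U₂` (`IsConj` in `GL₂`, ★ `IsStablyConj`) is invariant under right translation by an element whose matrix commutes with every matrix of `GL₂`.**
[cite: Rogawski1990, §3.1 p. 19] -/
theorem isConj_coe_mul_of_isConj {γ δ m : (UnitaryGroup.cmDatum L 2 (Matrix.of fun i j : Fin 2 => if i.val + j.val + 1 = 2 then (1 : L) else 0)).Local v} (hm : ∀ c : GL (Fin 2) (UnitaryGroup.LocalRing L v), c * (m.val : GL (Fin 2) (UnitaryGroup.LocalRing L v)) = m.val * c)
    (h : IsConj ((γ.val : GL (Fin 2) (UnitaryGroup.LocalRing L v))) (δ.val : GL (Fin 2) (UnitaryGroup.LocalRing L v))) :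
    IsConj (((γ * m : (UnitaryGroup.cmDatum L 2 (Matrix.of fun i j : Fin 2 => if i.val + j.val + 1 = 2 then (1 : L) else 0)).Local v).val : GL (Fin 2) (UnitaryGroup.LocalRing L v))) ((δ * m : (UnitaryGroup.cmDatum L 2 (Matrix.of fun i j : Fin 2 => if i.val + j.val + 1 = 2 then (1 : L) else 0)).Local v).val : GL (Fin 2) (UnitaryGroup.LocalRing L v)) := by
  obtain ⟨c, hc⟩ := isConj_iff.1 h
  refine isConj_iff.2 ⟨c, ?_⟩
  have e1 : ((γ * m : (UnitaryGroup.cmDatum L 2 (Matrix.of fun i j : Fin 2 => if i.val + j.val + 1 = 2 then (1 : L) else 0)).Local v).val : GL (Fin 2) (UnitaryGroup.LocalRing L v)) = γ.val * m.val := rfl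
  have e2 : ((δ * m : (UnitaryGroup.cmDatum L 2 (Matrix.of fun i j : Fin 2 => if i.val + j.val + 1 = 2 then (1 : L) else 0)).Local v).val : GL (Fin 2) (UnitaryGroup.LocalRing L v)) = δ.val * m.val := rfl
  rw [e1, e2, ← hc]
  calc c * ((γ.val : GL (Fin 2) (UnitaryGroup.LocalRing L v)) * m.val) * c⁻¹ = c * γ.val * (m.val * c⁻¹) := by simp only [mul_assoc]
    _ = c * γ.val * (c⁻¹ * m.val) := by rw [← hm c⁻¹]
    _ = c * γ.val * c⁻¹ * m.val := by simp only [mul_assoc]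

/-- Iterates of the translated map: `(γ ↦ Ψ(γm⁻¹)·m)^[k] (t·m) = Ψ^[k] t · m`. [folklore] -/
theorem iterate_translate {G : Type*} [Group G] (Ψ : G → G) (m t : G) (k : ℕ) :
    (fun γ : G => Ψ (γ * m⁻¹) * m)^[k] (t * m) = Ψ^[k] t * m := by
  induction k with
  | zero => rfl
  | succ k ih => rw [Function.iterate_succ_apply', Function.iterate_succ_apply', ih, mul_inv_cancel_right]

/-! ## §2 (SC_ζ) from (SC₁): the translation transport -/

/-- **(SC₁) AT THE UNIPOTENT CLASSES ⇒ (SC_ζ) AT THE CLASSES OVER A CENTRAL `ζ`**, for the translated pair `Ψ^ζ(γ) = Ψ(γζ⁻¹)·ζ`, `U₀^ζ = {γ | γζ⁻¹ ∈ U₀}` and exponent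
`a(⟦out u · ζ⁻¹⟧)`, every admissible `U₂`-family.  Exact transport along `U₂ ⧸ Z(x) = U₂ ⧸ Z(xζ⁻¹)`, then docking at `out⟦xζ⁻¹⟧` (FILE 4a's pattern).
[cite: Rogawski1990, §8.1 Prop. 8.1.2 (a) p. 114; §4.9 p. 54] [cite: Folland1995, Thm. 2.49] -/
theorem classOrbitalIntegral_indicator_comp_translate_eq_mul
    [MeasurableSpace ((UnitaryGroup.cmDatum L 2 (Matrix.of fun i j : Fin 2 => if i.val + j.val + 1 = 2 then (1 : L) else 0)).Local v)] [BorelSpace ((UnitaryGroup.cmDatum L 2 (Matrix.of fun i j : Fin 2 => if i.val + j.val + 1 = 2 then (1 : L) else 0)).Local v)]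
    [∀ γ : (UnitaryGroup.cmDatum L 2 (Matrix.of fun i j : Fin 2 => if i.val + j.val + 1 = 2 then (1 : L) else 0)).Local v, MeasurableSpace ((UnitaryGroup.cmDatum L 2 (Matrix.of fun i j : Fin 2 => if i.val + j.val + 1 = 2 then (1 : L) else 0)).Local v ⧸ Subgroup.centralizer ({γ} : Set ((UnitaryGroup.cmDatum L 2 (Matrix.of fun i j : Fin 2 => if i.val + j.val + 1 = 2 then (1 : L) else 0)).Local v)))]
    [∀ γ : (UnitaryGroup.cmDatum L 2 (Matrix.of fun i j : Fin 2 => if i.val + j.val + 1 = 2 then (1 : L) else 0)).Local v, BorelSpace ((UnitaryGroup.cmDatum L 2 (Matrix.of fun i j : Fin 2 => if i.val + j.val + 1 = 2 then (1 : L) else 0)).Local v ⧸ Subgroup.centralizer ({γ} : Set ((UnitaryGroup.cmDatum L 2 (Matrix.of fun i j : Fin 2 => if i.val + j.val + 1 = 2 then (1 : L) else 0)).Local v)))]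
    {Ψ : (UnitaryGroup.cmDatum L 2 (Matrix.of fun i j : Fin 2 => if i.val + j.val + 1 = 2 then (1 : L) else 0)).Local v → (UnitaryGroup.cmDatum L 2 (Matrix.of fun i j : Fin 2 => if i.val + j.val + 1 = 2 then (1 : L) else 0)).Local v} {U₀ : Set ((UnitaryGroup.cmDatum L 2 (Matrix.of fun i j : Fin 2 => if i.val + j.val + 1 = 2 then (1 : L) else 0)).Local v)} {q : ℂ} {a : ConjClasses ((UnitaryGroup.cmDatum L 2 (Matrix.of fun i j : Fin 2 => if i.val + j.val + 1 = 2 then (1 : L) else 0)).Local v) → ℕ}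
    {ζ : (UnitaryGroup.cmDatum L 2 (Matrix.of fun i j : Fin 2 => if i.val + j.val + 1 = 2 then (1 : L) else 0)).Local v} (hζ : ζ ∈ Subgroup.center ((UnitaryGroup.cmDatum L 2 (Matrix.of fun i j : Fin 2 => if i.val + j.val + 1 = 2 then (1 : L) else 0)).Local v))
    (hSC : ∀ (S₁ : Finset (ConjClasses ((UnitaryGroup.cmDatum L 2 (Matrix.of fun i j : Fin 2 => if i.val + j.val + 1 = 2 then (1 : L) else 0)).Local v))) (mU₁ : OrbitalMeasureFamily ((UnitaryGroup.cmDatum L 2 (Matrix.of fun i j : Fin 2 => if i.val + j.val + 1 = 2 then (1 : L) else 0)).Local v)),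
        (∀ u ∈ S₁, (((Quotient.out u : (UnitaryGroup.cmDatum L 2 (Matrix.of fun i j : Fin 2 => if i.val + j.val + 1 = 2 then (1 : L) else 0)).Local v).val : GL (Fin 2) (UnitaryGroup.LocalRing L v)).val - 1) ^ 2 = 0) →
        mU₁.IsAdmissibleOn (fun γ : (UnitaryGroup.cmDatum L 2 (Matrix.of fun i j : Fin 2 => if i.val + j.val + 1 = 2 then (1 : L) else 0)).Local v => ConjClasses.mk γ ∈ S₁) →
        ∀ u ∈ S₁, ∀ G : (UnitaryGroup.cmDatum L 2 (Matrix.of fun i j : Fin 2 => if i.val + j.val + 1 = 2 then (1 : L) else 0)).Local v → ℂ, IsLocSmooth G →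
          classOrbitalIntegral mU₁ (U₀.indicator (G ∘ Ψ)) u = q ^ (a u) * classOrbitalIntegral mU₁ G u)
    (S₂ : Finset (ConjClasses ((UnitaryGroup.cmDatum L 2 (Matrix.of fun i j : Fin 2 => if i.val + j.val + 1 = 2 then (1 : L) else 0)).Local v))) (mU₂ : OrbitalMeasureFamily ((UnitaryGroup.cmDatum L 2 (Matrix.of fun i j : Fin 2 => if i.val + j.val + 1 = 2 then (1 : L) else 0)).Local v))
    (hunip₂ : ∀ u ∈ S₂, (((Quotient.out u * ζ⁻¹ : (UnitaryGroup.cmDatum L 2 (Matrix.of fun i j : Fin 2 => if i.val + j.val + 1 = 2 then (1 : L) else 0)).Local v).val : GL (Fin 2) (UnitaryGroup.LocalRing L v)).val - 1) ^ 2 = 0)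
    (hadm₂ : mU₂.IsAdmissibleOn (fun γ : (UnitaryGroup.cmDatum L 2 (Matrix.of fun i j : Fin 2 => if i.val + j.val + 1 = 2 then (1 : L) else 0)).Local v => ConjClasses.mk γ ∈ S₂))
    {u : ConjClasses ((UnitaryGroup.cmDatum L 2 (Matrix.of fun i j : Fin 2 => if i.val + j.val + 1 = 2 then (1 : L) else 0)).Local v)} (hu : u ∈ S₂) (G : (UnitaryGroup.cmDatum L 2 (Matrix.of fun i j : Fin 2 => if i.val + j.val + 1 = 2 then (1 : L) else 0)).Local v → ℂ) (hG : IsLocSmooth G) :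
    classOrbitalIntegral mU₂ ({γ : (UnitaryGroup.cmDatum L 2 (Matrix.of fun i j : Fin 2 => if i.val + j.val + 1 = 2 then (1 : L) else 0)).Local v | γ * ζ⁻¹ ∈ U₀}.indicator (G ∘ fun γ : (UnitaryGroup.cmDatum L 2 (Matrix.of fun i j : Fin 2 => if i.val + j.val + 1 = 2 then (1 : L) else 0)).Local v => Ψ (γ * ζ⁻¹) * ζ)) u =
      q ^ (a (ConjClasses.mk (Quotient.out u * ζ⁻¹))) * classOrbitalIntegral mU₂ G u := by
  classical
  have hζc : ∀ k : (UnitaryGroup.cmDatum L 2 (Matrix.of fun i j : Fin 2 => if i.val + j.val + 1 = 2 then (1 : L) else 0)).Local v, k * ζ = ζ * k := fun k => Subgroup.mem_center_iff.1 hζ k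
  have hζi : ∀ k : (UnitaryGroup.cmDatum L 2 (Matrix.of fun i j : Fin 2 => if i.val + j.val + 1 = 2 then (1 : L) else 0)).Local v, k * ζ⁻¹ = ζ⁻¹ * k := comm_inv_of_comm hζc
  set x : (UnitaryGroup.cmDatum L 2 (Matrix.of fun i j : Fin 2 => if i.val + j.val + 1 = 2 then (1 : L) else 0)).Local v := Quotient.out u with hxdef
  set x' : (UnitaryGroup.cmDatum L 2 (Matrix.of fun i j : Fin 2 => if i.val + j.val + 1 = 2 then (1 : L) else 0)).Local v := x * ζ⁻¹ with hx'def
  have hmk : ConjClasses.mk x = u := Quotient.out_eq u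
  have hPu : ConjClasses.mk (Quotient.out u) ∈ S₂ := by
    rw [show ConjClasses.mk (Quotient.out u) = u from Quotient.out_eq u]
    exact hu
  obtain ⟨hne, hinv, hfin⟩ := hadm₂ u hPu
  haveI := hinv
  haveI := hfin
  haveI : IsClosed ((Subgroup.centralizer ({x} : Set ((UnitaryGroup.cmDatum L 2 (Matrix.of fun i j : Fin 2 => if i.val + j.val + 1 = 2 then (1 : L) else 0)).Local v)) : Subgroup ((UnitaryGroup.cmDatum L 2 (Matrix.of fun i j : Fin 2 => if i.val + j.val + 1 = 2 then (1 : L) else 0)).Local v)) : Set ((UnitaryGroup.cmDatum L 2 (Matrix.of fun i j : Fin 2 => if i.val + j.val + 1 = 2 then (1 : L) else 0)).Local v)) := isClosed_coe_centralizer_singleton x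
  haveI : IsClosed ((Subgroup.centralizer ({x'} : Set ((UnitaryGroup.cmDatum L 2 (Matrix.of fun i j : Fin 2 => if i.val + j.val + 1 = 2 then (1 : L) else 0)).Local v)) : Subgroup ((UnitaryGroup.cmDatum L 2 (Matrix.of fun i j : Fin 2 => if i.val + j.val + 1 = 2 then (1 : L) else 0)).Local v)) : Set ((UnitaryGroup.cmDatum L 2 (Matrix.of fun i j : Fin 2 => if i.val + j.val + 1 = 2 then (1 : L) else 0)).Local v)) := isClosed_coe_centralizer_singleton x'
  -- `Z(x′) = Z(x)`: the transport of `μ = mU₂ u` along the identity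
  have hxx' : x' * ζ = x := by rw [hx'def, inv_mul_cancel_right]
  have hCC : Subgroup.centralizer ({x'} : Set ((UnitaryGroup.cmDatum L 2 (Matrix.of fun i j : Fin 2 => if i.val + j.val + 1 = 2 then (1 : L) else 0)).Local v)) = Subgroup.centralizer ({x} : Set ((UnitaryGroup.cmDatum L 2 (Matrix.of fun i j : Fin 2 => if i.val + j.val + 1 = 2 then (1 : L) else 0)).Local v)) := by
    rw [← hxx']
    exact (centralizer_mul_central_eq hζc x').symm
  have hHH' : ∀ g : (UnitaryGroup.cmDatum L 2 (Matrix.of fun i j : Fin 2 => if i.val + j.val + 1 = 2 then (1 : L) else 0)).Local v, (MulEquiv.refl ((UnitaryGroup.cmDatum L 2 (Matrix.of fun i j : Fin 2 => if i.val + j.val + 1 = 2 then (1 : L) else 0)).Local v)) g ∈ Subgroup.centralizer ({x'} : Set ((UnitaryGroup.cmDatum L 2 (Matrix.of fun i j : Fin 2 => if i.val + j.val + 1 = 2 then (1 : L) else 0)).Local v)) ↔ g ∈ Subgroup.centralizer ({x} : Set ((UnitaryGroup.cmDatum L 2 (Matrix.of fun i j : Fin 2 => if i.val + j.val + 1 =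 2 then (1 : L) else 0)).Local v)) := fun g => by
    rw [hCC]
    rfl
  set ψ := cosetCongrHomeomorph (MulEquiv.refl ((UnitaryGroup.cmDatum L 2 (Matrix.of fun i j : Fin 2 => if i.val + j.val + 1 = 2 then (1 : L) else 0)).Local v)) (Subgroup.centralizer ({x} : Set ((UnitaryGroup.cmDatum L 2 (Matrix.of fun i j : Fin 2 => if i.val + j.val + 1 = 2 then (1 : L) else 0)).Local v))) (Subgroup.centralizer ({x'} : Set ((UnitaryGroup.cmDatum L 2 (Matrix.of fun i j : Fin 2 => if i.val + j.val + 1 = 2 then (1 : L) else 0)).Local v))) hHH' continuous_id continuous_id with hψdef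
  set μ' : Measure ((UnitaryGroup.cmDatum L 2 (Matrix.of fun i j : Fin 2 => if i.val + j.val + 1 = 2 then (1 : L) else 0)).Local v ⧸ Subgroup.centralizer ({x'} : Set ((UnitaryGroup.cmDatum L 2 (Matrix.of fun i j : Fin 2 => if i.val + j.val + 1 = 2 then (1 : L) else 0)).Local v))) := Measure.map ψ (mU₂ u) with hμ'def
  haveI hμ'i : SMulInvariantMeasure ((UnitaryGroup.cmDatum L 2 (Matrix.of fun i j : Fin 2 => if i.val + j.val + 1 = 2 then (1 : L) else 0)).Local v) _ μ' := by
    rw [hμ'def, show (ψ : _ → _) = cosetCongr (MulEquiv.refl ((UnitaryGroup.cmDatum L 2 (Matrix.of fun i j : Fin 2 => if i.val + j.val + 1 = 2 then (1 : L) else 0)).Local v)) _ _ hHH' from rfl]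
    exact smulInvariantMeasure_map_cosetCongr_of_smulInvariant (MulEquiv.refl ((UnitaryGroup.cmDatum L 2 (Matrix.of fun i j : Fin 2 => if i.val + j.val + 1 = 2 then (1 : L) else 0)).Local v)) continuous_id _ _ hHH' (mU₂ u)
  haveI hμ'f : IsFiniteMeasureOnCompacts μ' := IsFiniteMeasureOnCompacts.map (mU₂ u) ψ
  have hμ'0 : μ' ≠ 0 := by
    rw [hμ'def, Ne, Measure.map_eq_zero_iff ψ.measurable.aemeasurable]
    exact hne
  -- the exact translation identity
  have htrans : ∀ K : (UnitaryGroup.cmDatum L 2 (Matrix.of fun i j : Fin 2 => if i.val + j.val + 1 = 2 then (1 : L) else 0)).Local v → ℂ, orbitalIntegral x K (mU₂ u) =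
      ∫ y, descConj x' (Subgroup.centralizer ({x'} : Set ((UnitaryGroup.cmDatum L 2 (Matrix.of fun i j : Fin 2 => if i.val + j.val + 1 = 2 then (1 : L) else 0)).Local v))) (centralizer_comm x') (fun g : (UnitaryGroup.cmDatum L 2 (Matrix.of fun i j : Fin 2 => if i.val + j.val + 1 = 2 then (1 : L) else 0)).Local v => K (g * ζ)) y ∂μ' := by
    intro K
    rw [orbitalIntegral_eq_integral_descConj, hμ'def, ← Homeomorph.toMeasurableEquiv_coe ψ, integral_map_equiv]
    refine integral_congr_ae (Eventually.of_forall fun y => ?_)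
    induction y using QuotientGroup.induction_on with
    | H g =>
      simp only [Homeomorph.toMeasurableEquiv_coe, hψdef, coe_cosetCongrHomeomorph, cosetCongr_mk, MulEquiv.refl_apply, descConj_mk]
      rw [← hxx', conj_mul_central hζc g x']
  -- docking at `out ⟦x′⟧`
  obtain ⟨y, hy⟩ := isConj_iff.1 (ConjClasses.mk_eq_mk_iff_isConj.1 (Quotient.out_eq (ConjClasses.mk x')).symm)
  have hee : ∀ g : (UnitaryGroup.cmDatum L 2 (Matrix.of fun i j : Fin 2 => if i.val + j.val + 1 = 2 then (1 : L) else 0)).Local v, (MulAut.conj y) g ∈ Subgroup.centralizer ({Quotient.out (ConjClasses.mk x')} : Set ((UnitaryGroup.cmDatum L 2 (Matrix.of fun i j : Fin 2 => if i.val + j.val + 1 = 2 then (1 : L) else 0)).Local v)) ↔ g ∈ Subgroup.centralizer ({x'} : Set ((UnitaryGroup.cmDatum L 2 (Matrix.of fun i j : Fin 2 => if i.val + j.val + 1 = 2 then (1 : L) else 0)).Local v)) := by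
    intro g
    rw [← hy]
    exact mulEquiv_apply_mem_centralizer_singleton_iff (MulAut.conj y) x' g
  have hconjc : Continuous (MulAut.conj y : (UnitaryGroup.cmDatum L 2 (Matrix.of fun i j : Fin 2 => if i.val + j.val + 1 = 2 then (1 : L) else 0)).Local v ≃* (UnitaryGroup.cmDatum L 2 (Matrix.of fun i j : Fin 2 => if i.val + j.val + 1 = 2 then (1 : L) else 0)).Local v) := (continuous_const.mul continuous_id).mul continuous_const
  have hconjs : Continuous (MulAut.conj y : (UnitaryGroup.cmDatum L 2 (Matrix.of fun i j : Fin 2 => if i.val + j.val + 1 = 2 then (1 : L) else 0)).Local v ≃* (UnitaryGroup.cmDatum L 2 (Matrix.of fun i j : Fin 2 => if i.val + j.val + 1 = 2 then (1 : L) else 0)).Local v).symm := (continuous_const.mul continuous_id).mul continuous_const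
  set ψ₂ := cosetCongrHomeomorph (MulAut.conj y) (Subgroup.centralizer ({x'} : Set ((UnitaryGroup.cmDatum L 2 (Matrix.of fun i j : Fin 2 => if i.val + j.val + 1 = 2 then (1 : L) else 0)).Local v))) (Subgroup.centralizer ({Quotient.out (ConjClasses.mk x')} : Set ((UnitaryGroup.cmDatum L 2 (Matrix.of fun i j : Fin 2 => if i.val + j.val + 1 = 2 then (1 : L) else 0)).Local v))) hee hconjc hconjs with hψ₂def
  set μ₂ : Measure ((UnitaryGroup.cmDatum L 2 (Matrix.of fun i j : Fin 2 => if i.val + j.val + 1 = 2 then (1 : L) else 0)).Local v ⧸ Subgroup.centralizer ({Quotient.out (ConjClasses.mk x')} : Set ((UnitaryGroup.cmDatum L 2 (Matrix.of fun i j : Fin 2 => if i.val + j.val + 1 = 2 then (1 : L) else 0)).Local v))) := Measure.map ψ₂ μ' with hμ₂def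
  haveI hμ₂i : SMulInvariantMeasure ((UnitaryGroup.cmDatum L 2 (Matrix.of fun i j : Fin 2 => if i.val + j.val + 1 = 2 then (1 : L) else 0)).Local v) _ μ₂ := by
    rw [hμ₂def, show (ψ₂ : _ → _) = cosetCongr (MulAut.conj y) _ _ hee from rfl]
    exact smulInvariantMeasure_map_cosetCongr_of_smulInvariant (MulAut.conj y) hconjc _ _ hee μ'
  haveI hμ₂f : IsFiniteMeasureOnCompacts μ₂ := IsFiniteMeasureOnCompacts.map μ' ψ₂
  have hμ₂0 : μ₂ ≠ 0 := by
    rw [hμ₂def, Ne, Measure.map_eq_zero_iff ψ₂.measurable.aemeasurable]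
    exact hμ'0
  set mU₁ : OrbitalMeasureFamily ((UnitaryGroup.cmDatum L 2 (Matrix.of fun i j : Fin 2 => if i.val + j.val + 1 = 2 then (1 : L) else 0)).Local v) := fun c' => if h : c' = ConjClasses.mk x' then h ▸ μ₂ else 0 with hmU₁def
  have hmU₁x : mU₁ (ConjClasses.mk x') = μ₂ := by simp [hmU₁def]
  have hlit : (((Quotient.out (ConjClasses.mk x') : (UnitaryGroup.cmDatum L 2 (Matrix.of fun i j : Fin 2 => if i.val + j.val + 1 = 2 then (1 : L) else 0)).Local v).val : GL (Fin 2) (UnitaryGroup.LocalRing L v)).val - 1) ^ 2 = 0 := by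
    rw [← hy]
    exact (npow_conj_sub_one_eq_zero_iff_two L v x' y 2).2 (hunip₂ u hu)
  have hunip₁ : ∀ u' ∈ ({ConjClasses.mk x'} : Finset (ConjClasses ((UnitaryGroup.cmDatum L 2 (Matrix.of fun i j : Fin 2 => if i.val + j.val + 1 = 2 then (1 : L) else 0)).Local v))),
      (((Quotient.out u' : (UnitaryGroup.cmDatum L 2 (Matrix.of fun i j : Fin 2 => if i.val + j.val + 1 = 2 then (1 : L) else 0)).Local v).val : GL (Fin 2) (UnitaryGroup.LocalRing L v)).val - 1) ^ 2 = 0 := by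
    intro u' hu'
    rw [Finset.mem_singleton] at hu'
    subst hu'
    exact hlit
  have hadm₁ : mU₁.IsAdmissibleOn (fun γ : (UnitaryGroup.cmDatum L 2 (Matrix.of fun i j : Fin 2 => if i.val + j.val + 1 = 2 then (1 : L) else 0)).Local v => ConjClasses.mk γ ∈ ({ConjClasses.mk x'} : Finset (ConjClasses ((UnitaryGroup.cmDatum L 2 (Matrix.of fun i j : Fin 2 => if i.val + j.val + 1 = 2 then (1 : L) else 0)).Local v)))) := by
    intro c' hc'
    have hmk2 : ∀ c : ConjClasses ((UnitaryGroup.cmDatum L 2 (Matrix.of fun i j : Fin 2 => if i.val + j.val + 1 = 2 then (1 : L) else 0)).Local v), ConjClasses.mk (Quotient.out c) = c := fun c => Quotient.out_eq c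
    have hc'' : c' = ConjClasses.mk x' := by
      have h := hc'
      simp only [hmk2, Finset.mem_singleton] at h
      exact h
    subst hc''
    rw [hmU₁x]
    exact ⟨hμ₂0, hμ₂i, hμ₂f⟩
  obtain ⟨c', hc'0, hc'⟩ := exists_integral_descConj_eq_smul_integral_descConj_of_conj_eq y hy μ' μ₂ hμ'0 hμ₂0
  have hclass : ∀ K : (UnitaryGroup.cmDatum L 2 (Matrix.of fun i j : Fin 2 => if i.val + j.val + 1 = 2 then (1 : L) else 0)).Local v → ℂ, classOrbitalIntegral mU₁ K (ConjClasses.mk x') =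
      c' • ∫ t, descConj x' (Subgroup.centralizer ({x'} : Set ((UnitaryGroup.cmDatum L 2 (Matrix.of fun i j : Fin 2 => if i.val + j.val + 1 = 2 then (1 : L) else 0)).Local v))) (centralizer_comm x') K t ∂μ' := by
    intro K
    rw [classOrbitalIntegral_eq, hmU₁x, orbitalIntegral_eq_integral_descConj]
    exact hc' K
  -- the translated test function and the law at `⟦x′⟧`
  set G₁ : (UnitaryGroup.cmDatum L 2 (Matrix.of fun i j : Fin 2 => if i.val + j.val + 1 = 2 then (1 : L) else 0)).Local v → ℂ := fun g => G (g * ζ) with hG₁def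
  have hG₁ : IsLocSmooth G₁ := by
    have h := isLocSmooth_comp_homeomorph (Homeomorph.mulRight ζ).symm hG
    have e : G ∘ ⇑(Homeomorph.mulRight ζ).symm.symm = G₁ := by
      funext g
      simp only [Homeomorph.symm_symm, Function.comp_apply, Homeomorph.coe_mulRight, hG₁def]
    rw [e] at h
    exact h
  have hSC₁ := hSC {ConjClasses.mk x'} mU₁ hunip₁ hadm₁ (ConjClasses.mk x') (Finset.mem_singleton_self _) G₁ hG₁
  rw [hclass, hclass] at hSC₁
  have hK : (fun g : (UnitaryGroup.cmDatum L 2 (Matrix.of fun i j : Fin 2 => if i.val + j.val + 1 = 2 then (1 : L) else 0)).Local v => ({γ : (UnitaryGroup.cmDatum L 2 (Matrix.of fun i j : Fin 2 => if i.val + j.val + 1 = 2 then (1 : L) else 0)).Local v | γ * ζ⁻¹ ∈ U₀}.indicator (G ∘ fun γ : (UnitaryGroup.cmDatum L 2 (Matrix.of fun i j : Fin 2 => if i.val + j.val + 1 = 2 then (1 : L) else 0)).Local v => Ψ (γ * ζ⁻¹) * ζ)) (g * ζ)) =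
      U₀.indicator (G₁ ∘ Ψ) := by
    funext g
    by_cases hg : g ∈ U₀
    · rw [Set.indicator_of_mem (show g * ζ ∈ {γ : (UnitaryGroup.cmDatum L 2 (Matrix.of fun i j : Fin 2 => if i.val + j.val + 1 = 2 then (1 : L) else 0)).Local v | γ * ζ⁻¹ ∈ U₀} by simpa only [Set.mem_setOf_eq, mul_inv_cancel_right] using hg),
        Set.indicator_of_mem hg]
      simp only [Function.comp_apply, mul_inv_cancel_right, hG₁def]
    · rw [Set.indicator_of_notMem (fun h => hg (by simpa only [Set.mem_setOf_eq, mul_inv_cancel_right] using h)), Set.indicator_of_notMem hg]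
  have hH₁ : classOrbitalIntegral mU₂ ({γ : (UnitaryGroup.cmDatum L 2 (Matrix.of fun i j : Fin 2 => if i.val + j.val + 1 = 2 then (1 : L) else 0)).Local v | γ * ζ⁻¹ ∈ U₀}.indicator (G ∘ fun γ : (UnitaryGroup.cmDatum L 2 (Matrix.of fun i j : Fin 2 => if i.val + j.val + 1 = 2 then (1 : L) else 0)).Local v => Ψ (γ * ζ⁻¹) * ζ)) u =
      ∫ t, descConj x' (Subgroup.centralizer ({x'} : Set ((UnitaryGroup.cmDatum L 2 (Matrix.of fun i j : Fin 2 => if i.val + j.val + 1 = 2 then (1 : L) else 0)).Local v))) (centralizer_comm x') (U₀.indicator (G₁ ∘ Ψ)) t ∂μ' := by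
    rw [classOrbitalIntegral_eq, htrans, hK]
  have hH₂ : classOrbitalIntegral mU₂ G u = ∫ t, descConj x' (Subgroup.centralizer ({x'} : Set ((UnitaryGroup.cmDatum L 2 (Matrix.of fun i j : Fin 2 => if i.val + j.val + 1 = 2 then (1 : L) else 0)).Local v))) (centralizer_comm x') G₁ t ∂μ' := by
    rw [classOrbitalIntegral_eq, htrans]
  have hc'C : ((c' : ℝ) : ℂ) ≠ 0 := by exact_mod_cast hc'0
  have hlaw : ∫ t, descConj x' (Subgroup.centralizer ({x'} : Set ((UnitaryGroup.cmDatum L 2 (Matrix.of fun i j : Fin 2 => if i.val + j.val + 1 = 2 then (1 : L) else 0)).Local v))) (centralizer_comm x') (U₀.indicator (G₁ ∘ Ψ)) t ∂μ' =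
      q ^ (a (ConjClasses.mk x')) * ∫ t, descConj x' (Subgroup.centralizer ({x'} : Set ((UnitaryGroup.cmDatum L 2 (Matrix.of fun i j : Fin 2 => if i.val + j.val + 1 = 2 then (1 : L) else 0)).Local v))) (centralizer_comm x') G₁ t ∂μ' := by
    rw [NNReal.smul_def, NNReal.smul_def, Complex.real_smul, Complex.real_smul] at hSC₁
    refine mul_left_cancel₀ hc'C ?_
    rw [hSC₁]
    ring
  rw [hH₁, hH₂, hlaw]

/-! ## §3 Clause lemmas for the translation by a central `ζ` -/

/-- **A central element of `U₂ = U(Φ₂)_v` commutes with every matrix of `GL₂(L ⊗ L⁺_v)`** (it is a scalar matrix: ★ `exists_coe_fst_eq_smul_one_of_mem_center` at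
`(ζ, 1) ∈ Z(H_v)`, one place above `v`). [cite: Rogawski1990, §4.9 p. 54; §1.9 p. 8] -/
theorem coe_mul_comm_of_mem_center (hns : Subsingleton (UnitaryGroup.PlacesOver L v)) {ζ : (UnitaryGroup.cmDatum L 2 (Matrix.of fun i j : Fin 2 => if i.val + j.val + 1 = 2 then (1 : L) else 0)).Local v}
    (hζ : ζ ∈ Subgroup.center ((UnitaryGroup.cmDatum L 2 (Matrix.of fun i j : Fin 2 => if i.val + j.val + 1 = 2 then (1 : L) else 0)).Local v)) (c : GL (Fin 2) (UnitaryGroup.LocalRing L v)) : c * (ζ.val : GL (Fin 2) (UnitaryGroup.LocalRing L v)) = ζ.val * c := by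
  obtain ⟨w⟩ := UnitaryGroup.PlacesOver.nonempty L v
  have hζH : ((ζ, (1 : (UnitaryGroup.cmDatum L 1 (Matrix.of fun i j : Fin 1 => if i.val + j.val + 1 = 1 then (1 : L) else 0)).Local v)) : (UnitaryGroup.cmDatum L 2 (Matrix.of fun i j : Fin 2 => if i.val + j.val + 1 = 2 then (1 : L) else 0)).Local v × (UnitaryGroup.cmDatum L 1 (Matrix.of fun i j : Fin 1 => if i.val + j.val + 1 = 1 then (1 : L) else 0)).Local v) ∈ Subgroup.center ((UnitaryGroup.cmDatum L 2 (Matrix.of fun i j : Fin 2 => if i.val + j.val + 1 = 2 then (1 : L) else 0)).Local v × (UnitaryGroup.cmDatum L 1 (Matrix.of fun i j : Fin 1 => if i.val + j.val + 1 = 1 then (1 : L) else 0)).Local v) :=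
    Subgroup.mem_center_iff.2 fun k => Prod.ext (Subgroup.mem_center_iff.1 hζ k.1) (by show k.2 * 1 = 1 * k.2; rw [mul_one, one_mul])
  obtain ⟨s, -, hs⟩ := exists_coe_fst_eq_smul_one_of_mem_center L v w hns hζH
  apply Units.ext
  show c.val * (ζ.val : GL (Fin 2) (UnitaryGroup.LocalRing L v)).val = (ζ.val : GL (Fin 2) (UnitaryGroup.LocalRing L v)).val * c.val
  have hs' : (ζ.val : GL (Fin 2) (UnitaryGroup.LocalRing L v)).val = s • (1 : Matrix (Fin 2) (Fin 2) (UnitaryGroup.LocalRing L v)) := hs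
  rw [hs', Matrix.mul_smul, Matrix.smul_mul, Matrix.mul_one, Matrix.one_mul]

/-- **Stable conjugacy in `H_v` (trivial `U₁`-slot) is invariant under right translation of the `U₂`-slot by a `GL₂`-central element.** [cite: Rogawski1990, §3.1 p. 19] -/
theorem isLocalStablyConjH_mul_right {γ δ m : (UnitaryGroup.cmDatum L 2 (Matrix.of fun i j : Fin 2 => if i.val + j.val + 1 = 2 then (1 : L) else 0)).Local v} (hm : ∀ c : GL (Fin 2) (UnitaryGroup.LocalRing L v), c * (m.val : GL (Fin 2) (UnitaryGroup.LocalRing L v)) = m.val * c)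
    (h : IsLocalStablyConjH L v (γ, (1 : (UnitaryGroup.cmDatum L 1 (Matrix.of fun i j : Fin 1 => if i.val + j.val + 1 = 1 then (1 : L) else 0)).Local v)) (δ, (1 : (UnitaryGroup.cmDatum L 1 (Matrix.of fun i j : Fin 1 => if i.val + j.val + 1 = 1 then (1 : L) else 0)).Local v))) : IsLocalStablyConjH L v (γ * m, (1 : (UnitaryGroup.cmDatum L 1 (Matrix.of fun i j : Fin 1 => if i.val + j.val + 1 = 1 then (1 : L) else 0)).Local v)) (δ * m, (1 : (UnitaryGroup.cmDatum L 1 (Matrix.of fun i j : Fin 1 => if i.val + j.val + 1 = 1 then (1 : L) else 0)).Local v)) :=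
  ⟨isConj_coe_mul_of_isConj L v hm h.1, h.2⟩

/-- (U1) translated: `{γ | γζ⁻¹ ∈ U₀}` is a neighbourhood of `ζ` when `U₀` is one of `1`. [folklore] -/
theorem translate_mem_nhds {U₀ : Set ((UnitaryGroup.cmDatum L 2 (Matrix.of fun i j : Fin 2 => if i.val + j.val + 1 = 2 then (1 : L) else 0)).Local v)} (hU1 : U₀ ∈ 𝓝 (1 : (UnitaryGroup.cmDatum L 2 (Matrix.of fun i j : Fin 2 => if i.val + j.val + 1 = 2 then (1 : L) else 0)).Local v)) (ζ : (UnitaryGroup.cmDatum L 2 (Matrix.of fun i j : Fin 2 => if i.val + j.val + 1 = 2 then (1 : L) else 0)).Local v) :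
    {γ : (UnitaryGroup.cmDatum L 2 (Matrix.of fun i j : Fin 2 => if i.val + j.val + 1 = 2 then (1 : L) else 0)).Local v | γ * ζ⁻¹ ∈ U₀} ∈ 𝓝 ζ := by
  have hcont : Continuous fun γ : (UnitaryGroup.cmDatum L 2 (Matrix.of fun i j : Fin 2 => if i.val + j.val + 1 = 2 then (1 : L) else 0)).Local v => γ * ζ⁻¹ := continuous_id.mul continuous_const
  have h1 : U₀ ∈ 𝓝 ((fun γ : (UnitaryGroup.cmDatum L 2 (Matrix.of fun i j : Fin 2 => if i.val + j.val + 1 = 2 then (1 : L) else 0)).Local v => γ * ζ⁻¹) ζ) := by simpa only [mul_inv_cancel] using hU1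
  exact hcont.continuousAt.preimage_mem_nhds h1

/-- (S_H) translated: local smoothness of the cut-off pull-back through `Ψ^ζ × id`, via the homeomorphism `(γ₁, γ₂) ↦ (γ₁ζ⁻¹, γ₂)` of `H_v`
(★ `isLocSmooth_comp_homeomorph`). [cite: HarishChandra1999AdmissibleDistributions, §3.1 Lemma 3.2] -/
theorem isLocSmooth_indicator_translate (Ψ : (UnitaryGroup.cmDatum L 2 (Matrix.of fun i j : Fin 2 => if i.val + j.val + 1 = 2 then (1 : L) else 0)).Local v → (UnitaryGroup.cmDatum L 2 (Matrix.of fun i j : Fin 2 => if i.val + j.val + 1 = 2 then (1 : L) else 0)).Local v) (U₀ : Set ((UnitaryGroup.cmDatum L 2 (Matrix.of fun i j : Fin 2 => if i.val + j.val + 1 = 2 then (1 : L) else 0)).Local v)) (ζ : (UnitaryGroup.cmDatum L 2 (Matrix.of fun i j : Fin 2 => if i.val + j.val + 1 = 2 then (1 : L) else 0)).Local v)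
    (hS : ∀ F : (UnitaryGroup.cmDatum L 2 (Matrix.of fun i j : Fin 2 => if i.val + j.val + 1 = 2 then (1 : L) else 0)).Local v × (UnitaryGroup.cmDatum L 1 (Matrix.of fun i j : Fin 1 => if i.val + j.val + 1 = 1 then (1 : L) else 0)).Local v → ℂ, IsLocSmooth F →
      IsLocSmooth ((U₀ ×ˢ (Set.univ : Set ((UnitaryGroup.cmDatum L 1 (Matrix.of fun i j : Fin 1 => if i.val + j.val + 1 = 1 then (1 : L) else 0)).Local v))).indicator (F ∘ fun γ : (UnitaryGroup.cmDatum L 2 (Matrix.of fun i j : Fin 2 => if i.val + j.val + 1 = 2 then (1 : L) else 0)).Local v × (UnitaryGroup.cmDatum L 1 (Matrix.of fun i j : Fin 1 => if i.val + j.val + 1 = 1 then (1 : L) else 0)).Local v => (Ψ γ.1, γ.2))))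
    (F : (UnitaryGroup.cmDatum L 2 (Matrix.of fun i j : Fin 2 => if i.val + j.val + 1 = 2 then (1 : L) else 0)).Local v × (UnitaryGroup.cmDatum L 1 (Matrix.of fun i j : Fin 1 => if i.val + j.val + 1 = 1 then (1 : L) else 0)).Local v → ℂ) (hF : IsLocSmooth F) :
    IsLocSmooth (({γ : (UnitaryGroup.cmDatum L 2 (Matrix.of fun i j : Fin 2 => if i.val + j.val + 1 = 2 then (1 : L) else 0)).Local v | γ * ζ⁻¹ ∈ U₀} ×ˢ (Set.univ : Set ((UnitaryGroup.cmDatum L 1 (Matrix.of fun i j : Fin 1 => if i.val + j.val + 1 = 1 then (1 : L) else 0)).Local v))).indicator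
      (F ∘ fun γ : (UnitaryGroup.cmDatum L 2 (Matrix.of fun i j : Fin 2 => if i.val + j.val + 1 = 2 then (1 : L) else 0)).Local v × (UnitaryGroup.cmDatum L 1 (Matrix.of fun i j : Fin 1 => if i.val + j.val + 1 = 1 then (1 : L) else 0)).Local v => ((fun γ : (UnitaryGroup.cmDatum L 2 (Matrix.of fun i j : Fin 2 => if i.val + j.val + 1 = 2 then (1 : L) else 0)).Local v => Ψ (γ * ζ⁻¹) * ζ) γ.1, γ.2))) := by
  classical
  have hF' : IsLocSmooth (F ∘ ⇑(Homeomorph.mulRight ((ζ, (1 : (UnitaryGroup.cmDatum L 1 (Matrix.of fun i j : Fin 1 => if i.val + j.val + 1 = 1 then (1 : L) else 0)).Local v)) : (UnitaryGroup.cmDatum L 2 (Matrix.of fun i j : Fin 2 => if i.val + j.val + 1 = 2 then (1 : L) else 0)).Local v × (UnitaryGroup.cmDatum L 1 (Matrix.of fun i j : Fin 1 => if i.val + j.val + 1 = 1 then (1 : L) else 0)).Local v))) := by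
    have h := isLocSmooth_comp_homeomorph (Homeomorph.mulRight ((ζ, (1 : (UnitaryGroup.cmDatum L 1 (Matrix.of fun i j : Fin 1 => if i.val + j.val + 1 = 1 then (1 : L) else 0)).Local v)) : (UnitaryGroup.cmDatum L 2 (Matrix.of fun i j : Fin 2 => if i.val + j.val + 1 = 2 then (1 : L) else 0)).Local v × (UnitaryGroup.cmDatum L 1 (Matrix.of fun i j : Fin 1 => if i.val + j.val + 1 = 1 then (1 : L) else 0)).Local v)).symm hF
    rwa [Homeomorph.symm_symm] at h
  have hcomp := isLocSmooth_comp_homeomorph (Homeomorph.mulRight ((ζ, (1 : (UnitaryGroup.cmDatum L 1 (Matrix.of fun i j : Fin 1 => if i.val + j.val + 1 = 1 then (1 : L) else 0)).Local v)) : (UnitaryGroup.cmDatum L 2 (Matrix.of fun i j : Fin 2 => if i.val + j.val + 1 = 2 then (1 : L) else 0)).Local v × (UnitaryGroup.cmDatum L 1 (Matrix.of fun i j : Fin 1 => if i.val + j.val + 1 = 1 then (1 : L) else 0)).Local v)) (hS _ hF')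
  have hfun : ({γ : (UnitaryGroup.cmDatum L 2 (Matrix.of fun i j : Fin 2 => if i.val + j.val + 1 = 2 then (1 : L) else 0)).Local v | γ * ζ⁻¹ ∈ U₀} ×ˢ (Set.univ : Set ((UnitaryGroup.cmDatum L 1 (Matrix.of fun i j : Fin 1 => if i.val + j.val + 1 = 1 then (1 : L) else 0)).Local v))).indicator
      (F ∘ fun γ : (UnitaryGroup.cmDatum L 2 (Matrix.of fun i j : Fin 2 => if i.val + j.val + 1 = 2 then (1 : L) else 0)).Local v × (UnitaryGroup.cmDatum L 1 (Matrix.of fun i j : Fin 1 => if i.val + j.val + 1 = 1 then (1 : L) else 0)).Local v => ((fun γ : (UnitaryGroup.cmDatum L 2 (Matrix.of fun i j : Fin 2 => if i.val + j.val + 1 = 2 then (1 : L) else 0)).Local v => Ψ (γ * ζ⁻¹) * ζ) γ.1, γ.2)) =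
      ((U₀ ×ˢ (Set.univ : Set ((UnitaryGroup.cmDatum L 1 (Matrix.of fun i j : Fin 1 => if i.val + j.val + 1 = 1 then (1 : L) else 0)).Local v))).indicator
        ((F ∘ ⇑(Homeomorph.mulRight ((ζ, (1 : (UnitaryGroup.cmDatum L 1 (Matrix.of fun i j : Fin 1 => if i.val + j.val + 1 = 1 then (1 : L) else 0)).Local v)) : (UnitaryGroup.cmDatum L 2 (Matrix.of fun i j : Fin 2 => if i.val + j.val + 1 = 2 then (1 : L) else 0)).Local v × (UnitaryGroup.cmDatum L 1 (Matrix.of fun i j : Fin 1 => if i.val + j.val + 1 = 1 then (1 : L) else 0)).Local v))) ∘ fun γ : (UnitaryGroup.cmDatum L 2 (Matrix.of fun i j : Fin 2 => if i.val + j.val + 1 = 2 then (1 : L) else 0)).Local v × (UnitaryGroup.cmDatum L 1 (Matrix.of fun i j : Fin 1 => if i.val + j.val + 1 = 1 then (1 : L) else 0)).Local v => (Ψ γ.1, γ.2))) ∘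
        ⇑(Homeomorph.mulRight ((ζ, (1 : (UnitaryGroup.cmDatum L 1 (Matrix.of fun i j : Fin 1 => if i.val + j.val + 1 = 1 then (1 : L) else 0)).Local v)) : (UnitaryGroup.cmDatum L 2 (Matrix.of fun i j : Fin 2 => if i.val + j.val + 1 = 2 then (1 : L) else 0)).Local v × (UnitaryGroup.cmDatum L 1 (Matrix.of fun i j : Fin 1 => if i.val + j.val + 1 = 1 then (1 : L) else 0)).Local v)).symm := by
    funext γ
    obtain ⟨γ₁, γ₂⟩ := γ
    simp only [Function.comp_apply, Homeomorph.mulRight_symm, Homeomorph.coe_mulRight, Prod.inv_mk, inv_one, Prod.mk_mul_mk, mul_one,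
      Set.indicator_apply, Set.mem_prod, Set.mem_univ, and_true, Set.mem_setOf_eq]
  rw [hfun]
  exact hcomp

/-- (RAY⁺) translated: from the ray datum of the package at `1` read at the central `ζ` (regular, elliptic, irreducible `Ψ^[k] t · ζ`, `Ψ^[k] t → 1`) to the ray
datum of the translated package (`(Ψ^ζ)^[k](tζ) = Ψ^[k] t · ζ → ζ`, `Z(gζ) = Z(g)`). [cite: Rogawski1990, §3.6 Lemma 3.6.1 p. 28; §8.1 Prop. 8.1.2 (b) p. 114] -/
theorem ray_translate (Ψ : (UnitaryGroup.cmDatum L 2 (Matrix.of fun i j : Fin 2 => if i.val + j.val + 1 = 2 then (1 : L) else 0)).Local v → (UnitaryGroup.cmDatum L 2 (Matrix.of fun i j : Fin 2 => if i.val + j.val + 1 = 2 then (1 : L) else 0)).Local v) (U₀ : Set ((UnitaryGroup.cmDatum L 2 (Matrix.of fun i j : Fin 2 => if i.val + j.val + 1 = 2 then (1 : L) else 0)).Local v)) {ζ : (UnitaryGroup.cmDatum L 2 (Matrix.of fun i j : Fin 2 => if i.val + j.val + 1 = 2 then (1 : L) else 0)).Local v} (hζc : ∀ k : (UnitaryGroup.cmDatum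 L 2 (Matrix.of fun i j : Fin 2 => if i.val + j.val + 1 = 2 then (1 : L) else 0)).Local v, k * ζ = ζ * k)
    (lam : (UnitaryGroup.cmDatum L 1 (Matrix.of fun i j : Fin 1 => if i.val + j.val + 1 = 1 then (1 : L) else 0)).Local v) {t : (UnitaryGroup.cmDatum L 2 (Matrix.of fun i j : Fin 2 => if i.val + j.val + 1 = 2 then (1 : L) else 0)).Local v} (htU : t ∈ U₀)
    (hreg : ∀ k : ℕ, IsLocalGRegular L v (Ψ^[k] t * ζ, lam)) (hcpt : ∀ k : ℕ, CompactSpace (Subgroup.centralizer ({Ψ^[k] t} : Set ((UnitaryGroup.cmDatum L 2 (Matrix.of fun i j : Fin 2 => if i.val + j.val + 1 = 2 then (1 : L) else 0)).Local v))))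
    (hirr : ∀ k : ℕ, Irreducible (((Ψ^[k] t * ζ : (UnitaryGroup.cmDatum L 2 (Matrix.of fun i j : Fin 2 => if i.val + j.val + 1 = 2 then (1 : L) else 0)).Local v).val : GL (Fin 2) (UnitaryGroup.LocalRing L v)).val.charpoly))
    (hlim : Tendsto (fun k : ℕ => Ψ^[k] t) atTop (𝓝 1)) :
    ∃ t' : (UnitaryGroup.cmDatum L 2 (Matrix.of fun i j : Fin 2 => if i.val + j.val + 1 = 2 then (1 : L) else 0)).Local v, t' ∈ {γ : (UnitaryGroup.cmDatum L 2 (Matrix.of fun i j : Fin 2 => if i.val + j.val + 1 = 2 then (1 : L) else 0)).Local v | γ * ζ⁻¹ ∈ U₀} ∧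
      (∀ k : ℕ, IsLocalGRegular L v ((fun γ : (UnitaryGroup.cmDatum L 2 (Matrix.of fun i j : Fin 2 => if i.val + j.val + 1 = 2 then (1 : L) else 0)).Local v => Ψ (γ * ζ⁻¹) * ζ)^[k] t', lam)) ∧
      (∀ k : ℕ, CompactSpace (Subgroup.centralizer ({(fun γ : (UnitaryGroup.cmDatum L 2 (Matrix.of fun i j : Fin 2 => if i.val + j.val + 1 = 2 then (1 : L) else 0)).Local v => Ψ (γ * ζ⁻¹) * ζ)^[k] t'} : Set ((UnitaryGroup.cmDatum L 2 (Matrix.of fun i j : Fin 2 => if i.val + j.val + 1 = 2 then (1 : L) else 0)).Local v)))) ∧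
      (∀ k : ℕ, Irreducible ((((fun γ : (UnitaryGroup.cmDatum L 2 (Matrix.of fun i j : Fin 2 => if i.val + j.val + 1 = 2 then (1 : L) else 0)).Local v => Ψ (γ * ζ⁻¹) * ζ)^[k] t').val : GL (Fin 2) (UnitaryGroup.LocalRing L v)).val.charpoly)) ∧
      Tendsto (fun k : ℕ => (fun γ : (UnitaryGroup.cmDatum L 2 (Matrix.of fun i j : Fin 2 => if i.val + j.val + 1 = 2 then (1 : L) else 0)).Local v => Ψ (γ * ζ⁻¹) * ζ)^[k] t') atTop (𝓝 ζ) := by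
  refine ⟨t * ζ, ?_, ?_, ?_, ?_, ?_⟩
  · rw [Set.mem_setOf_eq, mul_inv_cancel_right]
    exact htU
  · intro k
    rw [iterate_translate]
    exact hreg k
  · intro k
    rw [iterate_translate, centralizer_mul_central_eq hζc]
    exact hcpt k
  · intro k
    rw [iterate_translate]
    exact hirr k
  · have h : Tendsto (fun k : ℕ => Ψ^[k] t * ζ) atTop (𝓝 (1 * ζ)) := hlim.mul_const ζ
    rw [one_mul] at h
    have hfun : (fun k : ℕ => (fun γ : (UnitaryGroup.cmDatum L 2 (Matrix.of fun i j : Fin 2 => if i.val + j.val + 1 = 2 then (1 : L) else 0)).Local v => Ψ (γ * ζ⁻¹) * ζ)^[k] (t * ζ)) = fun k : ℕ => Ψ^[k] t * ζ :=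
      funext fun k => iterate_translate Ψ ζ t k
    rw [hfun]
    exact h

end Summit.HodgeConjecture.HodgeConjecture.Cruxes.H413.K2E3RankOneUnipotentScalingTranslate

end
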